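import Summits.Ventures.HSemireg.ContractionSpanThetaSecant
import Summits.Ventures.HSemireg.ContractionSpanDegreeOne
import Summits.Ventures.HSemireg.ContractionRankPointIdeal
import Mathlib.LinearAlgebra.Finsupp.LinearCombination
import HarnessLib

/-!
# Venture HSemireg — the theta-secant factor on a Darboux basis: `r₂(a·1 + b·e^{c}) = 2·C(n,2)` (`n ≥ 3`),
# `= 1` (`n = 2`), `r₁ = 2n` (`n ≥ 2`) for `c = Σᵢ pᵢ ∧ qᵢ`, and the real-carrier `contractionRank` form

HONEST FRAMING. Pure linear algebra continuing `ContractionSpanThetaSecant.lean` (seat p6 of the computation cell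
`pub-hsemireg`; th-7's theta-divisor 2-secant factor, `theory/FORMULA-N-th7.md` §E row TH, Def. A.2, §B.3–B.4):
the structure theorem `span = W ⊔ e^{c}W`, `finrank = dim W + rank(c ∧ · on W)` instantiated at the 2-vector
`c = Σᵢ pᵢ ∧ qᵢ` of a DARBOUX basis `(p₁,…,pₙ,q₁,…,qₙ)` of `V` (the tree's `ExteriorLefschetz.twoVector`; `L = span{qᵢ}`,
`Θ = L^⊥`; on an abelian variety: `c = c₁` of a principal polarisation, `qᵢ` a basis of `H^{0,1}`, `pᵢ ∈ H^{1,0}` the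
dual frame). The Lefschetz input is the tree's hard Lefschetz in the exterior algebra
(`ExteriorLefschetz.IsSymplectic.eq_zero_of_pow_mul_eq_zero`, [Lange2023AbelianVarietiesComplex] §7.3.2 (1)): `c ∧ ·` is
injective on `Λ²` for `n ≥ 3` and on `Λ¹` for `n ≥ 2`. Nothing here is a claim about any explicit variety; nothing here
says that HC / HC_CM / HC_AV holds. Everything is PROVED; no named fact, no new definition.

Contents: §1 the degree-one companion (`span₁ = ι(L) ⊔ e^{c}ι(L)`, `finrank = dim L + rank(c ∧ · on ι(L))`);
§2 Darboux bookkeeping (`c` is a twist class of `L`, `c^{n+1} = 0`, `ι_{pⱼ*} c = qⱼ` — non-degeneracy, `dim L = n`);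
§3 the numbers `2·C(n,2)` / `1` / `2n`; §4 `contractionRank A κ = 2·C(g,2)` (`g ≥ 3`) and `= 1` (`g = 2`) on the real
carriers of `PerfectComplexRankDoor.lean` under the BY-VALUE shape hypothesis «`Σ_p κ_p = a·1 + b·e^{c}` in `Λ H¹(A)`,
`c = Σᵢ pᵢ ∧ qᵢ` for a Darboux basis with `qᵢ ∈ H^{0,1}`» (how a consumer says «`κ = ch` of a two-term theta-divisor
class, e.g. `ch(i_*𝒪_Θ(Θ)) = e^{θ} - 1`», th-7 §N.5 dictionary; an INPUT, not derived — the tree's `ChernCharacterBetti`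
has no `⊗`). References: [BourbakiAlgebre1a3] Ch. III §7, §11 no. 9; [BuchweitzFlenner2008HH] Prop. 6.4.4;
[Lange2023AbelianVarietiesComplex] §7.3.2; [McDuffSalamon2017] Thm. 2.1.3 (Darboux bases); [MumfordAV1970] §1, §4 (iii).
-/

noncomputable section

open CliffordAlgebra (contractLeft)
open ExteriorAlgebra (ι)
open Module
open Literature.AlgebraicGeometry.Motives Literature.AlgebraicGeometry.HodgeTheory

namespace Summit.Ventures.HSemireg

namespace ContractionSpan

/-! ### 1. Degree one: `span₁ L Θ (a·1 + b·E) = ι(L) ⊔ E·ι(L)` -/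

section Ring
variable {K : Type*} [CommRing K] {V : Type*} [AddCommGroup V] [Module K V]
variable {L : Set V} {Θ : Set (Module.Dual K V)} {c E : ExteriorAlgebra K V}

/-- `span (ι L)` is the vector block. [cite: BourbakiAlgebre1a3, Ch. III §7] -/
theorem mem_vecBlock_of_mem_span_image {β : ExteriorAlgebra K V} (hβ : β ∈ Submodule.span K (ι K '' L)) :
    β ∈ vecBlock (K := K) L :=
  (Submodule.span_mono (by rintro y ⟨q, hq, rfl⟩; exact ⟨q, hq, rfl⟩)) hβ

/-- `q ∧ (a·1 + b·E) = a·q + b·E ∧ q` for central `E`. [cite: BourbakiAlgebre1a3, Ch. III §7] -/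
theorem gen₁_vec_secant (hEc : ∀ z, Commute E z) (a b : K) (q : V) :
    ι K q * (algebraMap K _ a + b • E) = a • ι K q + b • (E * ι K q) := by
  rw [mul_add, ← Algebra.commutes, ← Algebra.smul_def, mul_smul_comm, (hEc (ι K q)).eq]

/-- `ι_φ (a·1 + b·E) = b·E ∧ ι_φ c` under the conjugation rule. [cite: BourbakiAlgebre1a3, Ch. III §11 no. 9] -/
theorem gen₁_contract_secant {φ : Module.Dual K V}
    (hED : ∀ z : ExteriorAlgebra K V, contractLeft φ (E * z) = E * (contractLeft φ z + contractLeft φ c * z))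
    (a b : K) : contractLeft φ (algebraMap K _ a + b • E) = b • (E * contractLeft φ c) := by
  rw [map_add, CliffordAlgebra.contractLeft_algebraMap, zero_add, map_smul, contractLeft_eq_mul_of_rule hED]

/-- **Degree-one structure theorem `span₁ L Θ (a·1 + b·E) = ι(L) ⊔ E·ι(L)`** (`Θ` kills `L`, `c` a twist class of
`L` non-degenerate on `Θ`, `E` central with the conjugation rule of `e^{c}`, `a, b` units).
[cite: BourbakiAlgebre1a3, Ch. III §11 no. 9] [cite: BuchweitzFlenner2008HH, Prop. 6.4.4] -/
theorem span₁_secant_eq (hΘL : ∀ θ ∈ Θ, ∀ q ∈ L, θ q = 0)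
    (hc : c ∈ Submodule.span K {z : ExteriorAlgebra K V | ∃ v : V, ∃ q ∈ L, z = ι K v * ι K q})
    (hEc : ∀ z, Commute E z)
    (hED : ∀ φ ∈ Θ, ∀ z : ExteriorAlgebra K V, contractLeft φ (E * z) = E * (contractLeft φ z + contractLeft φ c * z))
    (hnd : ∀ q ∈ L, ι K q ∈ Submodule.span K {y : ExteriorAlgebra K V | ∃ φ ∈ Θ, y = contractLeft φ c})
    {a b : K} (ha : IsUnit a) (hb : IsUnit b) :
    span₁ L Θ (algebraMap K _ a + b • E) = vecBlock L ⊔ (vecBlock L).map (LinearMap.mulLeft K E) := by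
  obtain ⟨ua, rfl⟩ := ha
  obtain ⟨ub, rfl⟩ := hb
  -- `E ∧ ι_φ c = b⁻¹ ι_φ x` lies in the span, hence so does `E ∧ q` for `q ∈ L` (non-degeneracy)
  have hE : ∀ q ∈ L, E * ι K q ∈ span₁ L Θ (algebraMap K _ (ua : K) + (ub : K) • E) := by
    intro q hq
    have key : ∀ β ∈ Submodule.span K {y : ExteriorAlgebra K V | ∃ φ ∈ Θ, y = contractLeft φ c},
        E * β ∈ span₁ L Θ (algebraMap K _ (ua : K) + (ub : K) • E) := by
      intro β hβ
      induction hβ using Submodule.span_induction with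
      | mem y hy =>
        obtain ⟨φ, hφ, rfl⟩ := hy
        have h : contractLeft φ (algebraMap K _ (ua : K) + (ub : K) • E) ∈ span₁ L Θ (algebraMap K _ (ua : K) + (ub : K) • E) :=
          Submodule.subset_span (Or.inr ⟨φ, hφ, rfl⟩)
        rw [gen₁_contract_secant (hED φ hφ)] at h
        have h' := Submodule.smul_mem _ (↑ub⁻¹ : K) h
        rwa [smul_smul, Units.inv_mul, one_smul] at h'
      | zero => rw [mul_zero]; exact Submodule.zero_mem _
      | add y z _ _ hy hz => rw [mul_add]; exact Submodule.add_mem _ hy hz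
      | smul r y _ hy => rw [mul_smul_comm]; exact Submodule.smul_mem _ r hy
    exact key _ (hnd q hq)
  apply le_antisymm
  · refine Submodule.span_le.mpr ?_
    rintro y (⟨q, hq, rfl⟩ | ⟨φ, hφ, rfl⟩)
    · rw [gen₁_vec_secant hEc]
      exact Submodule.add_mem _ (Submodule.mem_sup_left (Submodule.smul_mem _ _ (Submodule.subset_span ⟨q, hq, rfl⟩)))
        (Submodule.mem_sup_right (Submodule.smul_mem _ _ ⟨_, Submodule.subset_span ⟨q, hq, rfl⟩, rfl⟩))
    · rw [gen₁_contract_secant (hED φ hφ)]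
      exact Submodule.mem_sup_right (Submodule.smul_mem _ _
        ⟨_, mem_vecBlock_of_mem_span_image (contractLeft_mem_span_image_of_mem_twist (hΘL φ hφ) hc), rfl⟩)
  · refine sup_le (Submodule.span_le.mpr ?_) (Submodule.map_le_iff_le_comap.mpr (Submodule.span_le.mpr ?_))
    · rintro y ⟨q, hq, rfl⟩
      have h1 : ι K q * (algebraMap K _ (ua : K) + (ub : K) • E) ∈ span₁ L Θ (algebraMap K _ (ua : K) + (ub : K) • E) :=
        Submodule.subset_span (Or.inl ⟨q, hq, rfl⟩)
      rw [gen₁_vec_secant hEc] at h1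
      have h3 := Submodule.sub_mem _ h1 (Submodule.smul_mem _ (ub : K) (hE q hq))
      rw [add_sub_cancel_right] at h3
      have h4 := Submodule.smul_mem _ (↑ua⁻¹ : K) h3
      rwa [smul_smul, Units.inv_mul, one_smul] at h4
    · rintro y ⟨q, hq, rfl⟩
      exact hE q hq

end Ring

section Field
variable {K : Type*} [Field K] [CharZero K] {V : Type*} [AddCommGroup V] [Module K V]

/-- **Degree-one rank formula**: `finrank span₁ L Θ (a·1 + b·e^{c}) = dim ι(L) + rank(c ∧ · on ι(L))`
(same hypotheses as `finrank_span_secant_eq_add`). [cite: BuchweitzFlenner2008HH, Prop. 6.4.4]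
[cite: Lange2023AbelianVarietiesComplex, §7.3.2] -/
theorem finrank_span₁_secant_eq_add {L : Set V} {Θ : Set (Module.Dual K V)} (hΘL : ∀ θ ∈ Θ, ∀ q ∈ L, θ q = 0)
    {c : ExteriorAlgebra K V}
    (hc : c ∈ Submodule.span K {z : ExteriorAlgebra K V | ∃ v : V, ∃ q ∈ L, z = ι K v * ι K q}) {N : ℕ}
    (hN : c ^ N = 0)
    (hnd : ∀ q ∈ L, ι K q ∈ Submodule.span K {y : ExteriorAlgebra K V | ∃ φ ∈ Θ, y = contractLeft φ c})
    {a b : K} (ha : a ≠ 0) (hb : b ≠ 0) [FiniteDimensional K (vecBlock (K := K) L)] :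
    finrank K (span₁ L Θ (algebraMap K _ a + b • ∑ k ∈ Finset.range N, ((k.factorial : K)⁻¹) • c ^ k)) =
      finrank K (vecBlock (K := K) L) + finrank K ↥((vecBlock (K := K) L).map (LinearMap.mulLeft K c)) := by
  have hc' := span_twist_le L hc
  rw [span₁_secant_eq hΘL hc (commute_expSum hc' N)
    (fun φ _ z => contractLeft_expSum_mul φ hc' hN z) hnd (Ne.isUnit ha) (Ne.isUnit hb)]
  exact finrank_sup_map_expSum_eq (vecBlock_le L) hc' hN

omit [CharZero K] in
/-- If `c ∧ ·` is injective on a block `W`, then `finrank (c ∧ W) = finrank W`. [folklore] -/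
theorem finrank_map_mulLeft_eq_of_forall {W : Submodule K (ExteriorAlgebra K V)} [FiniteDimensional K W]
    {c : ExteriorAlgebra K V} (h : ∀ w ∈ W, c * w = 0 → w = 0) :
    finrank K ↥(W.map (LinearMap.mulLeft K c)) = finrank K W := by
  rw [← LinearMap.range_domRestrict]
  refine LinearMap.finrank_range_of_inj fun x y hxy => Subtype.ext (sub_eq_zero.mp (h _ (Submodule.sub_mem _ x.2 y.2) ?_))
  rw [mul_sub, sub_eq_zero]
  exact hxy

/-! ### 2. Darboux bookkeeping for `c = Σᵢ pᵢ ∧ qᵢ`, `L = span{qᵢ}`, `Θ = L^⊥` -/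

section Darboux
variable {n : ℕ} (b : Module.Basis (Fin n ⊕ Fin n) K V)

omit [CharZero K] in
/-- `c = Σᵢ pᵢ ∧ qᵢ` is a twist class of `L = span{qᵢ}` (type `(1,1)`). [cite: McDuffSalamon2017, Thm. 2.1.3] -/
theorem twoVector_mem_twist :
    ExteriorLefschetz.twoVector b ∈ Submodule.span K {z : ExteriorAlgebra K V |
      ∃ v : V, ∃ q ∈ (Submodule.span K (Set.range (⇑b ∘ Sum.inr)) : Set V), z = ι K v * ι K q} :=
  Submodule.sum_mem _ fun i _ =>
    Submodule.subset_span ⟨b (Sum.inl i), b (Sum.inr i), Submodule.subset_span ⟨i, rfl⟩, rfl⟩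

omit [CharZero K] in
/-- `c^{n+1} = 0` (`c^{n+1} ∈ Λ^{2n+2} V = 0`, `dim V = 2n`). [cite: BourbakiAlgebre1a3, Ch. III §7 no. 3 Prop. 6] -/
theorem twoVector_pow_succ_eq_zero : ExteriorLefschetz.twoVector b ^ (n + 1) = 0 := by
  have h := ExteriorLefschetz.pow_mem_exteriorPower (ExteriorLefschetz.twoVector_mem b) (n + 1)
  rwa [(ExteriorLefschetz.isSymplectic_twoVector b).exteriorPower_eq_bot (by omega : 2 * n < 2 * (n + 1)),
    Submodule.mem_bot] at h

omit [CharZero K] in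
/-- The coordinate forms `pⱼ*` kill `L = span{qᵢ}`. [cite: BourbakiAlgebre1a3, Ch. II §7 no. 5] -/
theorem coord_inl_apply_eq_zero (j : Fin n) {q : V} (hq : q ∈ Submodule.span K (Set.range (⇑b ∘ Sum.inr))) :
    b.coord (Sum.inl j) q = 0 := by
  rw [← LinearMap.mem_ker]
  refine (Submodule.span_le.mpr ?_) hq
  rintro _ ⟨i, rfl⟩
  rw [SetLike.mem_coe, LinearMap.mem_ker, Function.comp_apply, Module.Basis.coord_apply, Module.Basis.repr_self,
    Finsupp.single_eq_of_ne Sum.inl_ne_inr]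

omit [CharZero K] in
/-- **Non-degeneracy of a principal polarisation**: `ι_{pⱼ*} (Σᵢ pᵢ ∧ qᵢ) = qⱼ`. [cite: McDuffSalamon2017, Thm. 2.1.3]
[cite: BourbakiAlgebre1a3, Ch. III §11 no. 9] -/
theorem contractLeft_coord_inl_twoVector (j : Fin n) :
    contractLeft (b.coord (Sum.inl j)) (ExteriorLefschetz.twoVector b) = ι K (b (Sum.inr j)) := by
  rw [ExteriorLefschetz.twoVector, map_sum]
  have hterm : ∀ i : Fin n, contractLeft (b.coord (Sum.inl j)) (ι K (b (Sum.inl i)) * ι K (b (Sum.inr i))) =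
      if i = j then ι K (b (Sum.inr i)) else 0 := by
    intro i
    rw [CliffordAlgebra.contractLeft_ι_mul, CliffordAlgebra.contractLeft_ι, Module.Basis.coord_apply,
      Module.Basis.coord_apply, Module.Basis.repr_self, Module.Basis.repr_self,
      Finsupp.single_eq_of_ne Sum.inl_ne_inr, map_zero, mul_zero, sub_zero, Finsupp.single_apply]
    by_cases hij : i = j
    · subst hij; rw [if_pos rfl, if_pos rfl, one_smul]
    · rw [if_neg (fun h => hij (Sum.inl_injective h)), if_neg hij, zero_smul]
  simp_rw [hterm]
  rw [Finset.sum_ite_eq' Finset.univ j, if_pos (Finset.mem_univ j)]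

omit [CharZero K] in
/-- Non-degeneracy in the form consumed by `span_secant_eq`: every `q ∈ L` has `ι q` in the span of the `ι_φ c`,
`φ ∈ Θ = L^⊥`. [cite: McDuffSalamon2017, Thm. 2.1.3] -/
theorem ι_mem_span_contractLeft_twoVector {q : V} (hq : q ∈ (Submodule.span K (Set.range (⇑b ∘ Sum.inr)) : Set V)) :
    ι K q ∈ Submodule.span K {y : ExteriorAlgebra K V |
      ∃ φ ∈ {θ : Module.Dual K V | ∀ q ∈ Submodule.span K (Set.range (⇑b ∘ Sum.inr)), θ q = 0},
        y = contractLeft φ (ExteriorLefschetz.twoVector b)} := by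
  have h : (Submodule.span K (Set.range (⇑b ∘ Sum.inr))).map (ι K) ≤ Submodule.span K {y : ExteriorAlgebra K V |
      ∃ φ ∈ {θ : Module.Dual K V | ∀ q ∈ Submodule.span K (Set.range (⇑b ∘ Sum.inr)), θ q = 0},
        y = contractLeft φ (ExteriorLefschetz.twoVector b)} := by
    rw [Submodule.map_span, Submodule.span_le]
    rintro _ ⟨_, ⟨j, rfl⟩, rfl⟩
    exact Submodule.subset_span ⟨b.coord (Sum.inl j), fun q hq => coord_inl_apply_eq_zero b j hq,
      by rw [Function.comp_apply, contractLeft_coord_inl_twoVector]⟩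
  exact h (Submodule.mem_map_of_mem hq)

omit [CharZero K] in
/-- `dim L = n` for `L = span{q₁, …, qₙ}`. [cite: BourbakiAlgebre1a3, Ch. II §7 no. 5] -/
theorem finrank_span_range_inr : finrank K (Submodule.span K (Set.range (⇑b ∘ Sum.inr))) = n := by
  rw [finrank_span_eq_card (b.linearIndependent.comp Sum.inr Sum.inr_injective), Fintype.card_fin]

/-! ### 3. The numbers: `r₂ = 2·C(n,2)` (`n ≥ 3`), `r₂ = 1` (`n = 2`), `r₁ = 2n` (`n ≥ 2`) -/

/-- **Hard Lefschetz on the `Λ²`-block**: for `n ≥ 3`, `c ∧ w = 0 ⇒ w = 0` for `w ∈ W ⊆ Λ² V` (the tree's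
`IsSymplectic.eq_zero_of_pow_mul_eq_zero` at `k = 2`, `j = 1`). [cite: Lange2023AbelianVarietiesComplex, §7.3.2 (1)] -/
theorem twoVector_mul_eq_zero_imp (hn : 3 ≤ n) {w : ExteriorAlgebra K V}
    (hw : w ∈ wedgeBlock (K := K) (Submodule.span K (Set.range (⇑b ∘ Sum.inr)) : Set V))
    (h0 : ExteriorLefschetz.twoVector b * w = 0) : w = 0 :=
  (ExteriorLefschetz.isSymplectic_twoVector b).eq_zero_of_pow_mul_eq_zero (k := 2) (j := 1) (by omega)
    (wedgeBlock_le _ hw) (by rwa [pow_one])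

/-- **THE THETA-SECANT FACTOR, `n ≥ 3`: `r₂(a·1 + b·e^{c}) = 2·C(n,2)`** for `c = Σᵢ pᵢ ∧ qᵢ` on a Darboux basis
(`dim V = 2n`, `L = span{qᵢ}` of dimension `n`, `Θ = L^⊥`), `a, b ≠ 0`, `c^N = 0`, `e^{c} = Σ_{k<N} cᵏ/k!`:
`dim Λ²L + rank(c ∧ · on Λ²L) = C(n,2) + C(n,2)` by hard Lefschetz. (th-7's profile entry `r₂ = n(n-1)` for the
theta-divisor 2-secant factor.) [cite: BuchweitzFlenner2008HH, Prop. 6.4.4]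
[cite: Lange2023AbelianVarietiesComplex, §7.3.2 (1)] -/
theorem finrank_span_thetaSecant (hn : 3 ≤ n) {N : ℕ} (hN : ExteriorLefschetz.twoVector b ^ N = 0)
    {a a' : K} (ha : a ≠ 0) (ha' : a' ≠ 0) :
    finrank K (span (Submodule.span K (Set.range (⇑b ∘ Sum.inr)) : Set V)
      {θ : Module.Dual K V | ∀ q ∈ Submodule.span K (Set.range (⇑b ∘ Sum.inr)), θ q = 0}
      (algebraMap K _ a + a' • ∑ k ∈ Finset.range N, ((k.factorial : K)⁻¹) • ExteriorLefschetz.twoVector b ^ k)) =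
      2 * n.choose 2 := by
  haveI : FiniteDimensional K V := Module.Finite.of_basis b
  haveI : FiniteDimensional K (wedgeBlock (K := K) (Submodule.span K (Set.range (⇑b ∘ Sum.inr)) : Set V)) :=
    Submodule.finiteDimensional_of_le (wedgeBlock_le _)
  rw [finrank_span_secant_eq_add (L := (Submodule.span K (Set.range (⇑b ∘ Sum.inr)) : Set V))
    (Θ := {θ : Module.Dual K V | ∀ q ∈ Submodule.span K (Set.range (⇑b ∘ Sum.inr)), θ q = 0})
    (fun θ hθ q hq => hθ q hq) (twoVector_mem_twist b) hN (fun q hq => ι_mem_span_contractLeft_twoVector b hq) ha ha',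
    finrank_map_mulLeft_eq_of_forall (fun w hw h0 => twoVector_mul_eq_zero_imp b hn hw h0), finrank_wedgeBlock,
    finrank_span_range_inr, two_mul]

/-- **THE THETA-SECANT FACTOR, degree one, `n ≥ 2`: `r₁(a·1 + b·e^{c}) = 2n`** (`dim ι(L) + rank(c ∧ · on ι(L)) = n + n`,
hard Lefschetz at `k = 1`, `j = 1`). [cite: BuchweitzFlenner2008HH, Prop. 6.4.4]
[cite: Lange2023AbelianVarietiesComplex, §7.3.2 (1)] -/
theorem finrank_span₁_thetaSecant (hn : 2 ≤ n) {N : ℕ} (hN : ExteriorLefschetz.twoVector b ^ N = 0)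
    {a a' : K} (ha : a ≠ 0) (ha' : a' ≠ 0) :
    finrank K (span₁ (Submodule.span K (Set.range (⇑b ∘ Sum.inr)) : Set V)
      {θ : Module.Dual K V | ∀ q ∈ Submodule.span K (Set.range (⇑b ∘ Sum.inr)), θ q = 0}
      (algebraMap K _ a + a' • ∑ k ∈ Finset.range N, ((k.factorial : K)⁻¹) • ExteriorLefschetz.twoVector b ^ k)) =
      2 * n := by
  haveI : FiniteDimensional K V := Module.Finite.of_basis b
  haveI : FiniteDimensional K (vecBlock (K := K) (Submodule.span K (Set.range (⇑b ∘ Sum.inr)) : Set V)) :=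
    Submodule.finiteDimensional_of_le (vecBlock_le _)
  have hL : ∀ w ∈ vecBlock (K := K) (Submodule.span K (Set.range (⇑b ∘ Sum.inr)) : Set V),
      ExteriorLefschetz.twoVector b * w = 0 → w = 0 := fun w hw h0 =>
    (ExteriorLefschetz.isSymplectic_twoVector b).eq_zero_of_pow_mul_eq_zero (k := 1) (j := 1) (by omega)
      (vecBlock_le _ hw) (by rwa [pow_one])
  rw [finrank_span₁_secant_eq_add (L := (Submodule.span K (Set.range (⇑b ∘ Sum.inr)) : Set V))
    (Θ := {θ : Module.Dual K V | ∀ q ∈ Submodule.span K (Set.range (⇑b ∘ Sum.inr)), θ q = 0})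
    (fun θ hθ q hq => hθ q hq) (twoVector_mem_twist b) hN (fun q hq => ι_mem_span_contractLeft_twoVector b hq) ha ha',
    finrank_map_mulLeft_eq_of_forall hL, finrank_vecBlock, finrank_span_range_inr, two_mul]

end Darboux

omit [CharZero K] in
/-- For `n = 2` the Lefschetz image of the `Λ²`-block vanishes: `(p₀∧q₀ + p₁∧q₁) ∧ q ∧ q' = 0` for `q, q' ∈ span{q₀, q₁}`
(three vectors of a plane). [cite: BourbakiAlgebre1a3, Ch. III §7 no. 3 Prop. 6] -/
theorem twoVector_two_mul_ι_mul_ι (b : Module.Basis (Fin 2 ⊕ Fin 2) K V) {q q' : V}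
    (hq : q ∈ Submodule.span K (Set.range (⇑b ∘ Sum.inr))) (hq' : q' ∈ Submodule.span K (Set.range (⇑b ∘ Sum.inr))) :
    ExteriorLefschetz.twoVector b * (ι K q * ι K q') = 0 := by
  obtain ⟨f, rfl⟩ := (Submodule.mem_span_range_iff_exists_fun K).mp hq
  obtain ⟨g, rfl⟩ := (Submodule.mem_span_range_iff_exists_fun K).mp hq'
  have hA : ∀ (p w : V) (x : ExteriorAlgebra K V), ι K p * (ι K w * (ι K w * x)) = 0 := fun p w x => by
    rw [← mul_assoc (ι K w), ExteriorAlgebra.ι_sq_zero, zero_mul, mul_zero]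
  have hB : ∀ p w w' : V, ι K p * (ι K w * (ι K w' * ι K w)) = 0 := fun p w w' => by
    rw [ExteriorLefschetz.ι_mul_ι_mul w w' (ι K w), ExteriorAlgebra.ι_sq_zero, mul_zero, neg_zero, mul_zero]
  have hC : ∀ (y : ExteriorAlgebra K V) (w : V), y * (ι K w * ι K w) = 0 := fun y w => by
    rw [ExteriorAlgebra.ι_sq_zero, mul_zero]
  simp only [ExteriorLefschetz.twoVector, Fin.sum_univ_two, Function.comp_apply, map_add, map_smul, mul_add, add_mul,
    smul_mul_assoc, mul_smul_comm, mul_assoc, hA, hB, hC, smul_zero, add_zero]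

/-- **THE THETA-SECANT FACTOR, `n = 2`: `r₂(a·1 + b·e^{c}) = 1`** (`dim V = 4`, `dim L = 2`; `c ∧ Λ²L = 0`, so the span
is the line `Λ²L` — th-7's profile `(1, 4, 1)`). [cite: BuchweitzFlenner2008HH, Prop. 6.4.4] -/
theorem finrank_span_thetaSecant_two (b : Module.Basis (Fin 2 ⊕ Fin 2) K V) {N : ℕ}
    (hN : ExteriorLefschetz.twoVector b ^ N = 0) {a a' : K} (ha : a ≠ 0) (ha' : a' ≠ 0) :
    finrank K (span (Submodule.span K (Set.range (⇑b ∘ Sum.inr)) : Set V)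
      {θ : Module.Dual K V | ∀ q ∈ Submodule.span K (Set.range (⇑b ∘ Sum.inr)), θ q = 0}
      (algebraMap K _ a + a' • ∑ k ∈ Finset.range N, ((k.factorial : K)⁻¹) • ExteriorLefschetz.twoVector b ^ k)) = 1 := by
  haveI : FiniteDimensional K V := Module.Finite.of_basis b
  haveI : FiniteDimensional K (wedgeBlock (K := K) (Submodule.span K (Set.range (⇑b ∘ Sum.inr)) : Set V)) :=
    Submodule.finiteDimensional_of_le (wedgeBlock_le _)
  have h0 : (wedgeBlock (K := K) (Submodule.span K (Set.range (⇑b ∘ Sum.inr)) : Set V)).map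
      (LinearMap.mulLeft K (ExteriorLefschetz.twoVector b)) = ⊥ := by
    rw [eq_bot_iff, Submodule.map_le_iff_le_comap]
    refine Submodule.span_le.mpr ?_
    rintro y ⟨q₁, hq₁, q₂, hq₂, rfl⟩
    rw [SetLike.mem_coe, Submodule.mem_comap, LinearMap.mulLeft_apply, twoVector_two_mul_ι_mul_ι b hq₁ hq₂]
    exact Submodule.zero_mem _
  rw [finrank_span_secant_eq_add (L := (Submodule.span K (Set.range (⇑b ∘ Sum.inr)) : Set V))
    (Θ := {θ : Module.Dual K V | ∀ q ∈ Submodule.span K (Set.range (⇑b ∘ Sum.inr)), θ q = 0})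
    (fun θ hθ q hq => hθ q hq) (twoVector_mem_twist b) hN (fun q hq => ι_mem_span_contractLeft_twoVector b hq) ha ha',
    h0, finrank_bot, add_zero, finrank_wedgeBlock, finrank_span_range_inr]
  rfl

end Field

end ContractionSpan

/-! ### 4. Bridge: `contractionRank` of a two-term theta class on an abelian variety -/

section Bridge
variable (A : AbelianVariety ℂ)

/-- A Darboux basis of `H¹(A)` whose `qᵢ` lie in `H^{0,1}` has `span{qᵢ} = H^{0,1}` and genus `g = dim A`.
[cite: MumfordAV1970, §1 (4) and §4 (iii)] -/
theorem span_range_inr_eq_hodgeZeroOne {m : ℕ} (hA : IsSmoothProjective m A.X) (hm : m = A.dim) {g : ℕ}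
    (b : Module.Basis (Fin g ⊕ Fin g) ℂ (complexBetti A.X 1)) (hb : ∀ i, b (Sum.inr i) ∈ hodgeZeroOneSet A) :
    Submodule.span ℂ (Set.range (⇑b ∘ Sum.inr)) = hodgeZeroOne hA ∧ g = A.dim := by
  subst hm
  haveI : Module.Finite ℂ (complexBetti A.X 1) := abelianVarietyCohomologyExteriorH1_holds.finite_one A
  have hg : g = A.dim := by
    have h := abelianVarietyCohomologyExteriorH1_holds.finrank_one A
    rw [Module.finrank_eq_card_basis b, Fintype.card_sum, Fintype.card_fin] at h
    omega
  refine ⟨Submodule.eq_of_le_of_finrank_eq (Submodule.span_le.mpr ?_) ?_, hg⟩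
  · rintro _ ⟨i, rfl⟩
    rw [coe_hodgeZeroOne_eq_hodgeZeroOneSet A hA rfl]
    exact hb i
  · rw [ContractionSpan.finrank_span_range_inr, AbelianVariety.finrank_hodgeZeroOne_eq_dim A hA, hg]

/-- **`r(A, κ) = 2·C(g, 2)` for a two-term theta class on an abelian variety of dimension `g ≥ 3`**: if
`Σ_p κ_p = a·1 + b·e^{c}` in `Λ H¹(A)` with `a, b ≠ 0`, `c = Σᵢ pᵢ ∧ qᵢ` the 2-vector of a Darboux basis of `H¹(A)`
whose `qᵢ` lie in `H^{0,1}` (a principal polarisation in an adapted frame), `c^N = 0`, then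
`contractionRank A κ = 2·C(g, 2)` (th-7's theta-divisor factor `r₂ = g(g-1)`, on the REAL carriers).
[cite: BuchweitzFlenner2008HH, Prop. 6.4.4] [cite: Lange2023AbelianVarietiesComplex, §7.3.2 (1)]
[cite: MumfordAV1970, §1 (4) and §4 (iii)] -/
theorem contractionRank_thetaSecant (κ : ∀ p : ℕ, complexBetti A.X (2 * p)) {g : ℕ}
    (b : Module.Basis (Fin g ⊕ Fin g) ℂ (complexBetti A.X 1)) (hb : ∀ i, b (Sum.inr i) ∈ hodgeZeroOneSet A)
    {N : ℕ} (hN : ExteriorLefschetz.twoVector b ^ N = 0) {a a' : ℂ} (ha : a ≠ 0) (ha' : a' ≠ 0)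
    (hx : totalExteriorClass A κ =
      algebraMap ℂ _ a + a' • ∑ k ∈ Finset.range N, ((k.factorial : ℂ)⁻¹) • ExteriorLefschetz.twoVector b ^ k)
    (hg : 3 ≤ g) : contractionRank A κ = ((2 * g.choose 2 : ℕ) : Cardinal) := by
  have hA : IsSmoothProjective A.dim A.X := AbelianVariety.isSmoothProjective_holds
  obtain ⟨hL, -⟩ := span_range_inr_eq_hodgeZeroOne A hA rfl b hb
  rw [contractionRank_eq_rank_span, hx, vectorFieldSet_eq A hA rfl, ← coe_hodgeZeroOne_eq_hodgeZeroOneSet A hA rfl, ← hL,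
    ← ContractionSpan.finrank_span_thetaSecant b hg hN ha ha']
  -- the span is finite-dimensional (it is `W ⊔ e^{c}W` for the finite block `W ⊆ Λ²`), so `rank = finrank`
  haveI : FiniteDimensional ℂ (complexBetti A.X 1) := Module.Finite.of_basis b
  haveI : FiniteDimensional ℂ (ContractionSpan.wedgeBlock (K := ℂ)
      (Submodule.span ℂ (Set.range (⇑b ∘ Sum.inr)) : Set (complexBetti A.X 1))) :=
    Submodule.finiteDimensional_of_le (ContractionSpan.wedgeBlock_le _)
  have hc' := ContractionSpan.span_twist_le _ (ContractionSpan.twoVector_mem_twist b)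
  rw [ContractionSpan.span_secant_eq (L := (Submodule.span ℂ (Set.range (⇑b ∘ Sum.inr)) : Set (complexBetti A.X 1)))
    (Θ := {θ : Module.Dual ℂ (complexBetti A.X 1) | ∀ q ∈ Submodule.span ℂ (Set.range (⇑b ∘ Sum.inr)), θ q = 0})
    (fun θ hθ q hq => hθ q hq) (ContractionSpan.twoVector_mem_twist b)
    (ContractionSpan.commute_expSum hc' N) (fun φ _ z => ContractionSpan.contractLeft_expSum_mul φ hc' hN z)
    (fun q hq => ContractionSpan.ι_mem_span_contractLeft_twoVector b hq) (Ne.isUnit ha) (Ne.isUnit ha')]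
  exact (Module.finrank_eq_rank ℂ _).symm

/-- **`r(A, κ) = 1` on an abelian SURFACE** (`g = 2`) for a two-term theta class (the Lefschetz image of `Λ²L`
vanishes). [cite: BuchweitzFlenner2008HH, Prop. 6.4.4] [cite: MumfordAV1970, §1 (4) and §4 (iii)] -/
theorem contractionRank_thetaSecant_two (κ : ∀ p : ℕ, complexBetti A.X (2 * p))
    (b : Module.Basis (Fin 2 ⊕ Fin 2) ℂ (complexBetti A.X 1)) (hb : ∀ i, b (Sum.inr i) ∈ hodgeZeroOneSet A)
    {N : ℕ} (hN : ExteriorLefschetz.twoVector b ^ N = 0) {a a' : ℂ} (ha : a ≠ 0) (ha' : a' ≠ 0)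
    (hx : totalExteriorClass A κ =
      algebraMap ℂ _ a + a' • ∑ k ∈ Finset.range N, ((k.factorial : ℂ)⁻¹) • ExteriorLefschetz.twoVector b ^ k) :
    contractionRank A κ = 1 := by
  have hA : IsSmoothProjective A.dim A.X := AbelianVariety.isSmoothProjective_holds
  obtain ⟨hL, -⟩ := span_range_inr_eq_hodgeZeroOne A hA rfl b hb
  rw [contractionRank_eq_rank_span, hx, vectorFieldSet_eq A hA rfl, ← coe_hodgeZeroOne_eq_hodgeZeroOneSet A hA rfl, ← hL]
  haveI : FiniteDimensional ℂ (complexBetti A.X 1) := Module.Finite.of_basis b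
  haveI : FiniteDimensional ℂ (ContractionSpan.wedgeBlock (K := ℂ)
      (Submodule.span ℂ (Set.range (⇑b ∘ Sum.inr)) : Set (complexBetti A.X 1))) :=
    Submodule.finiteDimensional_of_le (ContractionSpan.wedgeBlock_le _)
  have hfin := ContractionSpan.finrank_span_thetaSecant_two b hN ha ha'
  have hc' := ContractionSpan.span_twist_le _ (ContractionSpan.twoVector_mem_twist b)
  rw [ContractionSpan.span_secant_eq (L := (Submodule.span ℂ (Set.range (⇑b ∘ Sum.inr)) : Set (complexBetti A.X 1)))
    (Θ := {θ : Module.Dual ℂ (complexBetti A.X 1) | ∀ q ∈ Submodule.span ℂ (Set.range (⇑b ∘ Sum.inr)), θ q = 0})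
    (fun θ hθ q hq => hθ q hq) (ContractionSpan.twoVector_mem_twist b)
    (ContractionSpan.commute_expSum hc' N) (fun φ _ z => ContractionSpan.contractLeft_expSum_mul φ hc' hN z)
    (fun q hq => ContractionSpan.ι_mem_span_contractLeft_twoVector b hq) (Ne.isUnit ha) (Ne.isUnit ha')] at hfin ⊢
  rw [← Module.finrank_eq_rank ℂ, hfin, Nat.cast_one]

end Bridge

end Summit.Ventures.HSemireg

end
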